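import Summits.QuantumFields.YangMills.Theorems.UnitScaleTiltProp7CovHodgeSplit
import HarnessLib

/-!
# Route `UnitScaleTilt`, crux K1 «MinimiserStabilityRegPr» (stmt-QuantumFields-19200), route-R E′ path (α′), row LEMMA-H-CURVED — FILE 1:
# THE BIHARMONIC DIRICHLET PRINCIPLE AT A UNITARY BACKGROUND.  If `Δ_U(Δ_U ψ) = 0` off the centre set `C` then `Σ_x‖(Δ_Uψ)(x)‖²_HS ≤ Σ_x‖(Δ_UΦ)(x)‖²_HS` for EVERY
# `Φ` agreeing with `ψ` on `C` — the `H⁻¹`-duality half of LEMMA H, covariant, with NO zero-mode ∕ neutrality hypothesis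

Cell `ym3-torus`, D-0154 (3c) twin-width seat `ym-routeR-w1` (gen 5); row «routeR-w1 g5: LEMMA-H-CURVED» (namer ★ym-ust-19200-p1 g14, 2026-08-28 17:33Z).
THEOREMS ONLY (0 `def`, 0 `sorry`); `--supports stmt-QuantumFields-19200`, count-neutral.  YM₃ on T³ is a ladder rung (R3), not the Clay problem; nothing here
claims a stub, the crux, d = 4 or the mass gap.

WHY.  The path-(α′) door ✓ `Prop7LocMinOfPinnedChartSlice.stub_PV3E_of_pinnedChartSliceM` leaves per competitor the ζ-row `DIV(D_H) ≤ ζ·K(D_H) + δ₁ℓ⁻²M` for the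
DIV-optimal representative `D_H` inside the pinned group; DIV-optimality says that the divergence `h = D*_W D_H` is CENTRE-HARMONIC: `Δ_W h = 0` off the k-centres
(`Δ_W = D*_W D_W`, [Balaban1985BackgroundPropagators] (3.3), (3.8)).  The flat engine ✓ `Prop7CentreHarmonicDivEngine` consumes LEMMA H in the shape
`Δ(Δψ) = 0 off C ⟹ ℓ·Σ_x(Δψ)² ≤ C_H·Σ_c(ψ(c₊) − ψ(c₋))²` (flat, Fourier: ✓ `Prop7CentreHarmonicDivFlat.lemmaH_flat`, ★routeR-w3 g5); its CURVED twin cannot be reached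
by Fourier.  ★routeR-w3 g4's constructive route (19200 evidence #41) is DUALITY + EXTENSION: (i) a centre-biharmonic `ψ` MINIMISES `Σ‖Δψ‖²` among all fields with the
same centre values, so (ii) ANY explicit extension `Φ` of the centre data bounds the left side.  THIS FILE is (i) at an arbitrary unitary background `U` on the torus
carrier of ✓ `Prop7CovHodgeSplit` (this lineage, gen 0): with `η = Φ − ψ` (`η = 0` on `C`), `Σ‖Δ_UΦ‖² = Σ‖Δ_Uψ‖² + Σ‖Δ_Uη‖² + 2Re Σ_x tr((Δ_Uψ)ᴴ·Δ_Uη)` and the cross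
term is `Σ_x tr(ηᴴ·Δ_U(Δ_Uψ))‾ = 0` by two Hilbert–Schmidt adjunctions `Σ⟨D_Uf, A⟩ = Σ⟨f, D*_UA⟩` (✓ `Prop7CovHodgeSplit.sum_trace_conjTranspose_covD_mul`) — sitewise
zero since `η` vanishes on `C` and `Δ_U²ψ` vanishes off `C`.  No neutrality, no spectral gap, no inversion: the zero-mode question of the curved LEMMA H lives
entirely in the extension (ii) (★w1-19200 g11's rule (2): constraint-massive bookkeeping), not here.

WHAT IS PROVED (ns `…Theorems.Prop7CentreBiharmonicDirichlet`; carrier `Site P i`, `M_N(ℂ)` fibres, unitary `U`; `Δ_Uψ := divB (torusT P i) U (fun μ y => covD (torusT P i) U μ ψ y)`).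
* §1 `lap_sub` (linearity), `sum_trace_conjTranspose_lap_mul` (`Σ_x tr((Δ_Uf)ᴴ·g) = Σ_{x,μ} tr((D_{U,μ}f)ᴴ·D_{U,μ}g)`), `sum_trace_conjTranspose_mul_lap`
  (`Σ_x tr(fᴴ·Δ_Ug) = Σ_{x,μ} tr((D_{U,μ}f)ᴴ·D_{U,μ}g)`), `sum_trace_lap_symm` (`Σ tr((Δ_Uf)ᴴ g) = Σ tr(fᴴ Δ_Ug)`).
* §2 ★★★ `sum_normSq_lap_le_of_eq_on_centres` — the biharmonic Dirichlet principle; ★ `lap_energy_le_of_extension` — the consumer's form: an extension `Φ` of the centre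
  data with `ℓ·Σ‖Δ_UΦ‖² ≤ R` gives `ℓ·Σ‖Δ_Uψ‖² ≤ R`.
* §3 the T³ ∕ `SU(2)` reading in the door's letters `unitsField (toUField W)`, centres `embIter (K − n)`: ★★ `sum_normSq_lap_le_of_eq_on_centres_T3`, `lap_energy_le_of_extension_T3`.
HONEST SCOPE.  Finite-dimensional algebra at an exact unitary background; the EXTENSION with its energy bound (the analytic half of LEMMA-H-curved: C¹ cardinal extension of
the coarse data, transported along `W`, curvature commutators) is NOT in this file; nothing of [Balaban1985BackgroundPropagators] beyond the cited letters is asserted.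

References: T. Bałaban, CMP 99 (1985) 389–434 [Balaban1985BackgroundPropagators] ((3.3)–(3.4) pp.390–391, (3.8) p.392, Thm 3.11 p.416); CMP 95 (1984) 17–40
[Balaban1984PropagatorsI] ((1.21) p.21, (1.29)–(1.31) p.23); CMP 102 (1985) 277–309 [Balaban1985Variational] (Prop. 7 p.299, (141)–(143) p.299).
-/

set_option autoImplicit false

noncomputable section

open scoped BigOperators Matrix.Norms.L2Operator Matrix

namespace Summit.QuantumFields.YangMills.Theorems.Prop7CentreBiharmonicDirichlet

open Literature.MathematicalPhysics.QuantumFieldTheory.Balaban1983to89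
open B9Eq39Adjoint (covD divB covD_sub)
open B9TorusCalculus (torusT)
open Summit.QuantumFields.YangMills.Theorems.Prop7CovHodgeSplit (divB_sub sum_trace_conjTranspose_covD_mul sum_normSq_add_eq
  unitsField_toUField_mem_unitary sum_dir_site_eq_sum_pbond)

/-! ## §1 The covariant Laplacian `Δ_U = D*_U D_U` on site fields: linearity and symmetry -/

section Torus

variable {P : Params} {i : ℕ} {N : ℕ} (U : Fin P.d → Site P i → (Matrix (Fin N) (Fin N) ℂ)ˣ)

/-- `Δ_U(Φ − ψ) = Δ_UΦ − Δ_Uψ`. [cite: Balaban1985BackgroundPropagators, (3.3) p.390, (3.8) p.392] -/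
theorem lap_sub (Φ ψ : Site P i → Matrix (Fin N) (Fin N) ℂ) (x : Site P i) :
    divB (torusT P i) U (fun μ y => covD (torusT P i) U μ (fun z => Φ z - ψ z) y) x
      = divB (torusT P i) U (fun μ y => covD (torusT P i) U μ Φ y) x - divB (torusT P i) U (fun μ y => covD (torusT P i) U μ ψ y) x := by
  rw [← divB_sub]
  congr 1
  funext μ y
  exact covD_sub (torusT P i) U μ Φ ψ y

variable (hU : ∀ (μ : Fin P.d) (x : Site P i), (U μ x : Matrix (Fin N) (Fin N) ℂ) ∈ unitary (Matrix (Fin N) (Fin N) ℂ))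
include hU

/-- `Σ_x tr(fᴴ·Δ_Ug) = Σ_{x,μ} tr((D_{U,μ}f)ᴴ·D_{U,μ}g)` (one adjunction (3.8)). [cite: Balaban1985BackgroundPropagators, (3.8) p.392] -/
theorem sum_trace_conjTranspose_mul_lap (f g : Site P i → Matrix (Fin N) (Fin N) ℂ) :
    ∑ x : Site P i, ((f x)ᴴ * divB (torusT P i) U (fun μ y => covD (torusT P i) U μ g y) x).trace
      = ∑ x : Site P i, ∑ μ : Fin P.d, ((covD (torusT P i) U μ f x)ᴴ * covD (torusT P i) U μ g x).trace :=
  (sum_trace_conjTranspose_covD_mul U hU f (fun μ y => covD (torusT P i) U μ g y)).symm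

/-- `Σ_x tr((Δ_Uf)ᴴ·g) = Σ_{x,μ} tr((D_{U,μ}f)ᴴ·D_{U,μ}g)` (the adjunction on the other side, via `tr(Xᴴ) = (tr X)‾`). [cite: Balaban1985BackgroundPropagators, (3.8) p.392] -/
theorem sum_trace_conjTranspose_lap_mul (f g : Site P i → Matrix (Fin N) (Fin N) ℂ) :
    ∑ x : Site P i, ((divB (torusT P i) U (fun μ y => covD (torusT P i) U μ f y) x)ᴴ * g x).trace
      = ∑ x : Site P i, ∑ μ : Fin P.d, ((covD (torusT P i) U μ f x)ᴴ * covD (torusT P i) U μ g x).trace := by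
  have h1 : ∀ x : Site P i, ((divB (torusT P i) U (fun μ y => covD (torusT P i) U μ f y) x)ᴴ * g x).trace
      = star (((g x)ᴴ * divB (torusT P i) U (fun μ y => covD (torusT P i) U μ f y) x).trace) := fun x => by
    rw [← Matrix.trace_conjTranspose, Matrix.conjTranspose_mul, Matrix.conjTranspose_conjTranspose]
  have h2 : ∀ (x : Site P i) (μ : Fin P.d), ((covD (torusT P i) U μ f x)ᴴ * covD (torusT P i) U μ g x).trace
      = star (((covD (torusT P i) U μ g x)ᴴ * covD (torusT P i) U μ f x).trace) := fun x μ => by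
    rw [← Matrix.trace_conjTranspose, Matrix.conjTranspose_mul, Matrix.conjTranspose_conjTranspose]
  simp only [h1, h2]
  rw [← star_sum, sum_trace_conjTranspose_mul_lap U hU g f, star_sum]
  simp only [star_sum]

/-- `Δ_U` is symmetric for the trace pairing: `Σ_x tr((Δ_Uf)ᴴ·g) = Σ_x tr(fᴴ·Δ_Ug)`. [cite: Balaban1985BackgroundPropagators, (3.8) p.392] -/
theorem sum_trace_lap_symm (f g : Site P i → Matrix (Fin N) (Fin N) ℂ) :
    ∑ x : Site P i, ((divB (torusT P i) U (fun μ y => covD (torusT P i) U μ f y) x)ᴴ * g x).trace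
      = ∑ x : Site P i, ((f x)ᴴ * divB (torusT P i) U (fun μ y => covD (torusT P i) U μ g y) x).trace := by
  rw [sum_trace_conjTranspose_lap_mul U hU, sum_trace_conjTranspose_mul_lap U hU]

/-! ## §2 The biharmonic Dirichlet principle -/

/-- ★★★ **THE BIHARMONIC DIRICHLET PRINCIPLE AT A UNITARY BACKGROUND.**  If `Δ_U(Δ_Uψ)` vanishes off `C` (the divergence `Δ_Uψ` is CENTRE-HARMONIC) then for every `Φ`
with `Φ = ψ` on `C`: `Σ_x‖(Δ_Uψ)(x)‖²_HS ≤ Σ_x‖(Δ_UΦ)(x)‖²_HS`.  With `η = Φ − ψ`: `Σ‖Δ_UΦ‖² = Σ‖Δ_Uψ‖² + Σ‖Δ_Uη‖² + 2Re Σ tr((Δ_Uψ)ᴴΔ_Uη)`, and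
`Σ_x tr((Δ_Uψ)ᴴ·Δ_Uη) = Σ_{x,μ} tr((D_μΔ_Uψ)ᴴ·D_μη) = (Σ_x tr(ηᴴ·Δ_U(Δ_Uψ)))‾ = 0` sitewise (`η = 0` on `C`, `Δ_U²ψ = 0` off `C`).  No neutrality or spectral gap is used.
[cite: Balaban1985BackgroundPropagators, (3.8) p.392, Thm 3.11 p.416; Balaban1984PropagatorsI, (1.29)-(1.31) p.23; Balaban1985Variational, Prop. 7 p.299] -/
theorem sum_normSq_lap_le_of_eq_on_centres (ψ : Site P i → Matrix (Fin N) (Fin N) ℂ) {C : Set (Site P i)}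
    (hψ : ∀ x : Site P i, x ∉ C →
      divB (torusT P i) U (fun μ y => covD (torusT P i) U μ
        (fun z => divB (torusT P i) U (fun ν w => covD (torusT P i) U ν ψ w) z) y) x = 0)
    (Φ : Site P i → Matrix (Fin N) (Fin N) ℂ) (hΦ : ∀ x ∈ C, Φ x = ψ x) :
    ∑ x : Site P i, ∑ a : Fin N, ∑ b : Fin N, Complex.normSq ((divB (torusT P i) U (fun μ y => covD (torusT P i) U μ ψ y) x) a b)
      ≤ ∑ x : Site P i, ∑ a : Fin N, ∑ b : Fin N, Complex.normSq ((divB (torusT P i) U (fun μ y => covD (torusT P i) U μ Φ y) x) a b) := by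
  classical
  set η : Site P i → Matrix (Fin N) (Fin N) ℂ := fun z => Φ z - ψ z with hη
  set u : Site P i → Matrix (Fin N) (Fin N) ℂ := fun z => divB (torusT P i) U (fun ν w => covD (torusT P i) U ν ψ w) z with hu
  set v : Site P i → Matrix (Fin N) (Fin N) ℂ := fun z => divB (torusT P i) U (fun ν w => covD (torusT P i) U ν η w) z with hv
  -- `Δ_UΦ = Δ_Uψ + Δ_Uη`
  have hsplit : ∀ x : Site P i, divB (torusT P i) U (fun μ y => covD (torusT P i) U μ Φ y) x = u x + v x := by
    intro x
    have hΦ' : Φ = fun z => (fun w => Φ w - ψ w) z + ψ z := by funext z; simp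
    have := lap_sub U Φ ψ x
    rw [hu, hv, hη]
    simp only
    rw [this]
    abel
  -- the cross term `Σ_x tr(uᴴ·v) = Σ_{x,μ} tr((D_μ u)ᴴ D_μ η) = star (Σ_x tr(ηᴴ Δ_U u)) = 0`
  have hcross : ∑ x : Site P i, ((u x)ᴴ * v x).trace = 0 := by
    have h1 : ∑ x : Site P i, ((u x)ᴴ * v x).trace = ∑ x : Site P i, ∑ μ : Fin P.d, ((covD (torusT P i) U μ u x)ᴴ * covD (torusT P i) U μ η x).trace := by
      rw [hv]; exact sum_trace_conjTranspose_mul_lap U hU u η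
    have h2 : ∑ x : Site P i, ∑ μ : Fin P.d, ((covD (torusT P i) U μ η x)ᴴ * covD (torusT P i) U μ u x).trace = 0 := by
      rw [← sum_trace_conjTranspose_mul_lap U hU η u]
      refine Finset.sum_eq_zero fun x _ => ?_
      by_cases hx : x ∈ C
      · have : η x = 0 := by rw [hη]; exact sub_eq_zero.mpr (hΦ x hx)
        rw [this, Matrix.conjTranspose_zero, Matrix.zero_mul, Matrix.trace_zero]
      · have h0 := hψ x hx
        rw [h0, Matrix.mul_zero, Matrix.trace_zero]
    have h3 : ∀ (x : Site P i) (μ : Fin P.d), ((covD (torusT P i) U μ u x)ᴴ * covD (torusT P i) U μ η x).trace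
        = star (((covD (torusT P i) U μ η x)ᴴ * covD (torusT P i) U μ u x).trace) := fun x μ => by
      rw [← Matrix.trace_conjTranspose, Matrix.conjTranspose_mul, Matrix.conjTranspose_conjTranspose]
    rw [h1]
    simp only [h3]
    rw [show (∑ x : Site P i, ∑ μ : Fin P.d, star (((covD (torusT P i) U μ η x)ᴴ * covD (torusT P i) U μ u x).trace))
        = star (∑ x : Site P i, ∑ μ : Fin P.d, ((covD (torusT P i) U μ η x)ᴴ * covD (torusT P i) U μ u x).trace) by
      rw [star_sum]; simp only [star_sum], h2, star_zero]
  have hcrossRe : (∑ x : Site P i, ((u x)ᴴ * v x).trace).re = 0 := by rw [hcross, Complex.zero_re]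
  -- expand `Σ|u + v|² = Σ|v|² + Σ|u|² + 2Re Σ tr(uᴴ v)` and drop `Σ|v|² ≥ 0`
  have hexp : ∑ x : Site P i, ∑ a : Fin N, ∑ b : Fin N, Complex.normSq ((divB (torusT P i) U (fun μ y => covD (torusT P i) U μ Φ y) x) a b)
      = ∑ x : Site P i, ∑ a : Fin N, ∑ b : Fin N, Complex.normSq ((v x) a b)
        + ∑ x : Site P i, ∑ a : Fin N, ∑ b : Fin N, Complex.normSq ((u x) a b)
        + 2 * ∑ x : Site P i, ((u x)ᴴ * v x).trace.re := by
    rw [Finset.mul_sum, ← Finset.sum_add_distrib, ← Finset.sum_add_distrib]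
    refine Finset.sum_congr rfl fun x _ => ?_
    rw [hsplit x, add_comm (u x) (v x), sum_normSq_add_eq]
  have hre : ∑ x : Site P i, ((u x)ᴴ * v x).trace.re = 0 := by
    have := hcrossRe
    rw [Complex.re_sum] at this
    exact this
  have hL : ∑ x : Site P i, ∑ a : Fin N, ∑ b : Fin N, Complex.normSq ((divB (torusT P i) U (fun μ y => covD (torusT P i) U μ ψ y) x) a b)
      = ∑ x : Site P i, ∑ a : Fin N, ∑ b : Fin N, Complex.normSq ((u x) a b) := rfl
  rw [hexp, hre, mul_zero, add_zero, hL]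
  have : 0 ≤ ∑ x : Site P i, ∑ a : Fin N, ∑ b : Fin N, Complex.normSq ((v x) a b) :=
    Finset.sum_nonneg fun _ _ => Finset.sum_nonneg fun _ _ => Finset.sum_nonneg fun _ _ => Complex.normSq_nonneg _
  linarith

/-- ★ **LEMMA-H-CURVED FROM AN EXTENSION ROW** (the consumer's form): if `Δ_U(Δ_Uψ) = 0` off `C` and SOME extension `Φ` of the centre data (`Φ = ψ` on `C`) has
`ℓ·Σ_x‖Δ_UΦ‖²_HS ≤ R` (`ℓ ≥ 0`), then `ℓ·Σ_x‖Δ_Uψ‖²_HS ≤ R`.  The analytic half of LEMMA-H-curved is thus the construction of ONE good extension of coarse data.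
[cite: Balaban1984PropagatorsI, (1.29)-(1.31) p.23; Balaban1985BackgroundPropagators, Thm 3.11 p.416; Balaban1985Variational, Prop. 7 p.299] -/
theorem lap_energy_le_of_extension (ψ : Site P i → Matrix (Fin N) (Fin N) ℂ) {C : Set (Site P i)}
    (hψ : ∀ x : Site P i, x ∉ C →
      divB (torusT P i) U (fun μ y => covD (torusT P i) U μ
        (fun z => divB (torusT P i) U (fun ν w => covD (torusT P i) U ν ψ w) z) y) x = 0)
    {ℓ R : ℝ} (hℓ : 0 ≤ ℓ)
    (hext : ∃ Φ : Site P i → Matrix (Fin N) (Fin N) ℂ, (∀ x ∈ C, Φ x = ψ x) ∧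
      ℓ * ∑ x : Site P i, ∑ a : Fin N, ∑ b : Fin N, Complex.normSq ((divB (torusT P i) U (fun μ y => covD (torusT P i) U μ Φ y) x) a b) ≤ R) :
    ℓ * ∑ x : Site P i, ∑ a : Fin N, ∑ b : Fin N, Complex.normSq ((divB (torusT P i) U (fun μ y => covD (torusT P i) U μ ψ y) x) a b) ≤ R := by
  obtain ⟨Φ, hΦ, hR⟩ := hext
  exact (mul_le_mul_of_nonneg_left (sum_normSq_lap_le_of_eq_on_centres U hU ψ hψ Φ hΦ) hℓ).trans hR

end Torus

/-! ## §3 The reading on the T³ carrier at an `SU(2)` background, centres `embIter (K − n)` -/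

section T3

open Literature.MathematicalPhysics.QuantumFieldTheory.Balaban1983to89.T3ContinuumYM3Torus
open B10Eq27TorusAxialLog (unitsField toUField)
open B15DeterminingSets (embIter)

/-- ★★ **THE BIHARMONIC DIRICHLET PRINCIPLE ON THE T³ CARRIER** (run `K`, comparison height `n`, `SU(2)` background `W`, the door's letters `unitsField (toUField W)`): if
`Δ_W(Δ_Wψ)` vanishes off the `(K−n)`-centres `embIter (K−n) y` then `Σ_x‖Δ_Wψ‖²_HS ≤ Σ_x‖Δ_WΦ‖²_HS` for every `Φ` with `Φ ∘ embIter (K−n) = ψ ∘ embIter (K−n)`.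
[cite: Balaban1985BackgroundPropagators, (3.8) p.392, Thm 3.11 p.416; Balaban1985Variational, Prop. 7 p.299, (141)-(143) p.299] -/
theorem sum_normSq_lap_le_of_eq_on_centres_T3 (F : T3Family) (K n : ℕ) (W : GaugeField (F.P K) 0 (Matrix.specialUnitaryGroup (Fin 2) ℂ))
    (ψ : Site (F.P K) 0 → Matrix (Fin 2) (Fin 2) ℂ)
    (hψ : ∀ x : Site (F.P K) 0, x ∉ Set.range (embIter (K - n)) →
      divB (torusT (F.P K) 0) (fun κ z => unitsField (toUField W) ⟨z, κ⟩) (fun κ y => covD (torusT (F.P K) 0) (fun κ z => unitsField (toUField W) ⟨z, κ⟩) κ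
        (fun z => divB (torusT (F.P K) 0) (fun κ z => unitsField (toUField W) ⟨z, κ⟩)
          (fun ν w => covD (torusT (F.P K) 0) (fun κ z => unitsField (toUField W) ⟨z, κ⟩) ν ψ w) z) y) x = 0)
    (Φ : Site (F.P K) 0 → Matrix (Fin 2) (Fin 2) ℂ) (hΦ : ∀ y : Site (F.P K) (K - n), Φ (embIter (K - n) y) = ψ (embIter (K - n) y)) :
    ∑ x : Site (F.P K) 0, ∑ a : Fin 2, ∑ b : Fin 2,
        Complex.normSq ((divB (torusT (F.P K) 0) (fun κ z => unitsField (toUField W) ⟨z, κ⟩)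
          (fun κ y => covD (torusT (F.P K) 0) (fun κ z => unitsField (toUField W) ⟨z, κ⟩) κ ψ y) x) a b)
      ≤ ∑ x : Site (F.P K) 0, ∑ a : Fin 2, ∑ b : Fin 2,
        Complex.normSq ((divB (torusT (F.P K) 0) (fun κ z => unitsField (toUField W) ⟨z, κ⟩)
          (fun κ y => covD (torusT (F.P K) 0) (fun κ z => unitsField (toUField W) ⟨z, κ⟩) κ Φ y) x) a b) := by
  refine sum_normSq_lap_le_of_eq_on_centres (fun κ z => unitsField (toUField W) ⟨z, κ⟩) (unitsField_toUField_mem_unitary W) ψ hψ Φ ?_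
  rintro x ⟨y, rfl⟩
  exact hΦ y

/-- ★ **LEMMA-H-CURVED FROM AN EXTENSION ROW, T³ reading**: `Δ_W(Δ_Wψ) = 0` off the `(K−n)`-centres and an extension `Φ` of `ψ ∘ embIter (K−n)` with
`L^{K−n}·Σ‖Δ_WΦ‖²_HS ≤ R` give `L^{K−n}·Σ‖Δ_Wψ‖²_HS ≤ R` — the shape in which the curved ENGINE displays LEMMA H.
[cite: Balaban1984PropagatorsI, (1.29)-(1.31) p.23; Balaban1985BackgroundPropagators, Thm 3.11 p.416; Balaban1985Variational, Prop. 7 p.299] -/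
theorem lap_energy_le_of_extension_T3 (F : T3Family) (K n : ℕ) (W : GaugeField (F.P K) 0 (Matrix.specialUnitaryGroup (Fin 2) ℂ))
    (ψ : Site (F.P K) 0 → Matrix (Fin 2) (Fin 2) ℂ)
    (hψ : ∀ x : Site (F.P K) 0, x ∉ Set.range (embIter (K - n)) →
      divB (torusT (F.P K) 0) (fun κ z => unitsField (toUField W) ⟨z, κ⟩) (fun κ y => covD (torusT (F.P K) 0) (fun κ z => unitsField (toUField W) ⟨z, κ⟩) κ
        (fun z => divB (torusT (F.P K) 0) (fun κ z => unitsField (toUField W) ⟨z, κ⟩)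
          (fun ν w => covD (torusT (F.P K) 0) (fun κ z => unitsField (toUField W) ⟨z, κ⟩) ν ψ w) z) y) x = 0)
    {R : ℝ}
    (hext : ∃ Φ : Site (F.P K) 0 → Matrix (Fin 2) (Fin 2) ℂ, (∀ y : Site (F.P K) (K - n), Φ (embIter (K - n) y) = ψ (embIter (K - n) y)) ∧
      (F.L : ℝ) ^ (K - n) * ∑ x : Site (F.P K) 0, ∑ a : Fin 2, ∑ b : Fin 2,
        Complex.normSq ((divB (torusT (F.P K) 0) (fun κ z => unitsField (toUField W) ⟨z, κ⟩)
          (fun κ y => covD (torusT (F.P K) 0) (fun κ z => unitsField (toUField W) ⟨z, κ⟩) κ Φ y) x) a b) ≤ R) :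
    (F.L : ℝ) ^ (K - n) * ∑ x : Site (F.P K) 0, ∑ a : Fin 2, ∑ b : Fin 2,
        Complex.normSq ((divB (torusT (F.P K) 0) (fun κ z => unitsField (toUField W) ⟨z, κ⟩)
          (fun κ y => covD (torusT (F.P K) 0) (fun κ z => unitsField (toUField W) ⟨z, κ⟩) κ ψ y) x) a b) ≤ R := by
  obtain ⟨Φ, hΦ, hR⟩ := hext
  have hL : (0 : ℝ) ≤ (F.L : ℝ) ^ (K - n) := by positivity
  exact (mul_le_mul_of_nonneg_left (sum_normSq_lap_le_of_eq_on_centres_T3 F K n W ψ hψ Φ hΦ) hL).trans hR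

end T3

end Summit.QuantumFields.YangMills.Theorems.Prop7CentreBiharmonicDirichlet

end
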